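import Literature.Analysis.Complex.VerticalLineShift
import Literature.Analysis.Complex.MellinBarnesShift
import Literature.Analysis.SpecialFunctions.GammaProductBounds
import Mathlib.MeasureTheory.Measure.Lebesgue.EqHaar
import HarnessLib

/-!
# Booker 2003: the contour identity (2) = (3) in the entire case — proofs only

A. R. Booker, *Poles of Artin L-functions and the strong Artin conjecture*, Ann. of Math. 158
(2003), 1089–1098, p. 1090: for `0 < δ < π/2`, `α > 0` rational and `m ≥ 1`, the sum

  (2) `Σ_{s₀ pole} Res_{s=s₀} L(s, ρ) (αe^{i(π/2−δ)})^{1/2−s} π^{-s}Γ((s+a)/2)² (s − 1/2)^{m−a}`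

"may be expressed as the difference of two contour integrals along vertical lines. Doing so and
using the functional equation (1) for `L(s, ρ)`, we arrive at"

  (3) `(1/2πi) ∫ [L(s, ρ)(αe^{i(π/2−δ)})^{1/2−s} − ε(−1)^{m−a} L(s, ρ̄)((Nα)^{-1}e^{−i(π/2−δ)})^{1/2−s}]`
      `· π^{-s}Γ((s+a)/2)²(s − 1/2)^{m−a} ds`.

For the Corollary ("the Artin conjecture for `ρ` implies the strong Artin conjecture for `ρ`") the
Theorem is used with `L(s, ρ)` ENTIRE, when (2) is the empty sum and the content of this step is
the identity (3) `= 0`.  This file proves exactly that, for an abstract pair of entire functions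
`Λ = γL`, `Λ̃ = γL̄` tied by the completed functional equation `Λ(s) = ε N^{1/2−s} Λ̃(1 − s)` and
with `Λ` decaying like `(1+‖s‖)^k e^{−π|Im s|/2}` in vertical strips (polynomial growth of `L` —
`Automorphic/BookerStrongArtinGrowth` — times Stirling for `γ`); the factor
`(αe^{iθ})^{1/2−s}` is written `exp((1/2 − s)(log α + iθ))`, `θ = π/2 − δ`:

* `norm_integrand_le` — `‖Λ(s)(αe^{iθ})^{1/2−s}(s−1/2)^n‖ ≤ K (1+|t|)^{k+n} e^{−(π/2−|θ|)|t|}` on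
  a strip ("`e^{−iπs/2}` cancels the decay of the Γ-factor", p. 1091);
* `integral_vertical_eq_of_decay` — the line integral `∫_{Re s = c} Λ(s)(αe^{iθ})^{1/2−s}(s−1/2)^n ds`
  is independent of `c` (`Literature.Analysis.Complex.integral_vertical_eq_of_differentiableOn`);
* `integral_vertical_reflect`, `integrand_one_sub_eq` — `s ↦ 1 − s` and the functional equation
  turn the integrand at `1 − w` into `ε(−1)^n Λ̃(w)((Nα)^{-1}e^{−iθ})^{1/2−w}(w−1/2)^n`;
* `integral_eq3_eq_zero` — **(3) = 0**:
  `∫_{Re s=c} [Λ(s)(αe^{iθ})^{1/2−s} − ε(−1)^n Λ̃(s)((Nα)^{-1}e^{−iθ})^{1/2−s}](s−1/2)^n ds = 0` for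
  every `c`, `α > 0`, `|θ| < π/2`, `n`.

This is the starting identity of the proof of the Theorem (pp. 1095–1097: Lemma 3 replaces the
`Γ`-factor by `Σ b_k (2π)^{-s}Γ(s+k−1/2)`, Lemma 2 — `LFunctions/ConreyGhoshTransform` — turns
each half into additive twists against `(2 sin δ/2)^{-s}`, Lemma 4 —
`Analysis/Complex/MellinInvContinuation` — detects a pole).  No definitions, no named facts
(D-0026).

## References

* A. R. Booker, Ann. of Math. (2) 158 (2003), 1089–1098: (1) p. 1089; (2)–(3) p. 1090; p. 1091.
  [Booker2003]

## Mathlib / tree search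

Tree: `Literature.Analysis.Complex.integral_vertical_eq_of_differentiableOn` (`VerticalLineShift`),
`exists_rpow_mul_exp_neg_le` (`MellinBarnesShift`),
`Literature.Analysis.SpecialFunctions.integrable_one_add_abs_rpow_mul_exp_neg`
(`GammaProductBounds`). Mathlib: `MeasureTheory.Measure.integral_comp_mul_left` (reflection
`y ↦ −y`), `Complex.cpow_def_of_ne_zero`, `Complex.ofReal_log`, `integral_sub`.
-/

noncomputable section

open Complex Real Set Filter Topology MeasureTheory

namespace Literature.NumberTheory.Automorphic

namespace Booker2003

/-! ### The integrand `F(s) = Λ(s) (α e^{iθ})^{1/2 − s} (s − 1/2)^n` and its size -/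

/-- `‖exp((1/2 − s)(log α + iθ))‖ = exp((1/2 − Re s) log α + θ Im s)` — the modulus of
`(α e^{iθ})^{1/2 − s}`. [folklore] -/
theorem norm_exp_half_sub_mul (s : ℂ) (α θ : ℝ) :
    ‖Complex.exp ((1 / 2 - s) * (Real.log α + θ * I))‖ =
      Real.exp ((1 / 2 - s.re) * Real.log α + θ * s.im) := by
  rw [Complex.norm_exp]
  congr 1
  simp only [Complex.mul_re, Complex.sub_re, Complex.sub_im, Complex.add_re, Complex.add_im,
    Complex.ofReal_re, Complex.ofReal_im, Complex.mul_im, Complex.I_re, Complex.I_im]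
  norm_num
  ring

/-- `1 + ‖x + iy‖ ≤ (1 + |x|)(1 + |y|)`. [folklore] -/
theorem one_add_norm_le (x y : ℝ) : 1 + ‖(x : ℂ) + y * I‖ ≤ (1 + |x|) * (1 + |y|) := by
  have h : ‖(x : ℂ) + y * I‖ ≤ |x| + |y| := by
    calc ‖(x : ℂ) + y * I‖ ≤ ‖(x : ℂ)‖ + ‖(y : ℂ) * I‖ := norm_add_le _ _
      _ = |x| + |y| := by simp
  nlinarith [abs_nonneg x, abs_nonneg y]

/-- **Size of the integrand on a vertical line.** If `‖Λ(s)‖ ≤ C (1 + ‖s‖)^k e^{−π|Im s|/2}` for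
`σ₁ ≤ Re s ≤ σ₂`, then for `x ∈ [σ₁, σ₂]` with `|x| ≤ R` and all real `y`,
`‖Λ(x+iy) (αe^{iθ})^{1/2−x−iy} (x + iy − 1/2)^n‖ ≤ C (1+R)^{k+n} α^{*} (1+|y|)^{k+n} e^{−(π/2 − |θ|)|y|}`
with `α^{*} = max(α^{1/2−σ₁}, α^{1/2−σ₂})`. [folklore] -/
theorem norm_integrand_le {Λ : ℂ → ℂ} {σ₁ σ₂ C R : ℝ} {k : ℕ}
    (hΛ : ∀ s : ℂ, σ₁ ≤ s.re → s.re ≤ σ₂ → ‖Λ s‖ ≤ C * (1 + ‖s‖) ^ k * Real.exp (-(π * |s.im|) / 2))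
    (hC : 0 ≤ C) {α : ℝ} (hα : 0 < α) (θ : ℝ) (n : ℕ) {x : ℝ} (hx₁ : σ₁ ≤ x) (hx₂ : x ≤ σ₂)
    (hxR : |x| ≤ R) (y : ℝ) :
    ‖Λ (x + y * I) * Complex.exp ((1 / 2 - (x + y * I)) * (Real.log α + θ * I)) *
        ((x + y * I) - 1 / 2) ^ n‖ ≤
      C * (1 + R) ^ (k + n) * max (α ^ (1 / 2 - σ₁)) (α ^ (1 / 2 - σ₂)) *
        ((1 + |y|) ^ (k + n) * Real.exp (-((π / 2 - |θ|) * |y|))) := by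
  set s : ℂ := (x : ℂ) + y * I with hs
  have hsre : s.re = x := by simp [hs]
  have hsim : s.im = y := by simp [hs]
  have hR0 : 0 ≤ R := (abs_nonneg x).trans hxR
  have h1s : 1 + ‖s‖ ≤ (1 + R) * (1 + |y|) :=
    (one_add_norm_le x y).trans (mul_le_mul_of_nonneg_right (by linarith) (by positivity))
  -- the three factors
  have hΛs : ‖Λ s‖ ≤ C * ((1 + R) * (1 + |y|)) ^ k * Real.exp (-(π * |y|) / 2) := by
    have h := hΛ s (by rw [hsre]; exact hx₁) (by rw [hsre]; exact hx₂)
    rw [hsim] at h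
    refine h.trans ?_
    gcongr
  have hE : ‖Complex.exp ((1 / 2 - s) * (Real.log α + θ * I))‖ ≤
      max (α ^ (1 / 2 - σ₁)) (α ^ (1 / 2 - σ₂)) * Real.exp (|θ| * |y|) := by
    rw [norm_exp_half_sub_mul, hsre, hsim, Real.exp_add]
    refine mul_le_mul ?_ (Real.exp_le_exp.mpr ?_) (Real.exp_pos _).le (by positivity)
    · -- `exp((1/2 - x) log α) = α^{1/2-x}` lies between the values at `σ₁`, `σ₂`
      rw [mul_comm, ← Real.rpow_def_of_pos hα]
      rcases le_or_gt 1 α with hα1 | hα1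
      · exact le_max_of_le_left (Real.rpow_le_rpow_of_exponent_le hα1 (by linarith))
      · exact le_max_of_le_right (Real.rpow_le_rpow_of_exponent_ge hα hα1.le (by linarith))
    · calc θ * y ≤ |θ * y| := le_abs_self _
        _ = |θ| * |y| := abs_mul _ _
  have hP : ‖(s - 1 / 2) ^ n‖ ≤ ((1 + R) * (1 + |y|)) ^ n := by
    rw [norm_pow]
    refine pow_le_pow_left₀ (norm_nonneg _) ?_ n
    calc ‖s - 1 / 2‖ ≤ ‖s‖ + ‖(1 / 2 : ℂ)‖ := norm_sub_le _ _
      _ ≤ 1 + ‖s‖ := by norm_num; linarith [norm_nonneg s]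
      _ ≤ (1 + R) * (1 + |y|) := h1s
  -- assemble
  have hexp : Real.exp (-(π * |y|) / 2) * Real.exp (|θ| * |y|) = Real.exp (-((π / 2 - |θ|) * |y|)) := by
    rw [← Real.exp_add]; congr 1; ring
  calc ‖Λ s * Complex.exp ((1 / 2 - s) * (Real.log α + θ * I)) * (s - 1 / 2) ^ n‖
      = ‖Λ s‖ * ‖Complex.exp ((1 / 2 - s) * (Real.log α + θ * I))‖ * ‖(s - 1 / 2) ^ n‖ := by
        rw [norm_mul, norm_mul]
    _ ≤ (C * ((1 + R) * (1 + |y|)) ^ k * Real.exp (-(π * |y|) / 2)) *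
          (max (α ^ (1 / 2 - σ₁)) (α ^ (1 / 2 - σ₂)) * Real.exp (|θ| * |y|)) *
          ((1 + R) * (1 + |y|)) ^ n :=
        mul_le_mul (mul_le_mul hΛs hE (norm_nonneg _) (by positivity)) hP (norm_nonneg _)
          (by positivity)
    _ = C * (1 + R) ^ (k + n) * max (α ^ (1 / 2 - σ₁)) (α ^ (1 / 2 - σ₂)) *
          ((1 + |y|) ^ (k + n) * (Real.exp (-(π * |y|) / 2) * Real.exp (|θ| * |y|))) := by
        rw [mul_pow, mul_pow, pow_add, pow_add]; ring
    _ = _ := by rw [hexp]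

/-! ### Line independence -/

/-- **The vertical integral of `F(s) = Λ(s) (αe^{iθ})^{1/2−s} (s − 1/2)^n` does not depend on the
line** when `Λ` is ENTIRE with `‖Λ(s)‖ ≤ C (1+‖s‖)^k e^{−π|Im s|/2}` in every vertical strip and
`|θ| < π/2` (Booker 2003, p. 1090–1091: under Artin's conjecture the sum (2) over the poles of
`L(s, ρ)` is empty, and "(2) may be expressed as the difference of two contour integrals along
vertical lines" — which therefore agree; the integrand decays like `e^{−δ|t|}`, `θ = π/2 − δ`,
"e^{−iπs/2} cancels the decay of the Γ-factor", p. 1091). [cite: Booker2003, pp. 1090–1091] -/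
theorem integral_vertical_eq_of_decay {Λ : ℂ → ℂ} (hΛd : Differentiable ℂ Λ)
    (hΛ : ∀ σ₁ σ₂ : ℝ, ∃ C : ℝ, 0 ≤ C ∧ ∃ k : ℕ, ∀ s : ℂ, σ₁ ≤ s.re → s.re ≤ σ₂ →
      ‖Λ s‖ ≤ C * (1 + ‖s‖) ^ k * Real.exp (-(π * |s.im|) / 2))
    {α θ : ℝ} (hα : 0 < α) (hθ : |θ| < π / 2) (n : ℕ) {c₁ c₂ : ℝ} (hc : c₁ ≤ c₂) :
    ∫ y : ℝ, Λ (c₁ + y * I) * Complex.exp ((1 / 2 - (c₁ + y * I)) * (Real.log α + θ * I)) *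
        ((c₁ + y * I) - 1 / 2) ^ n =
      ∫ y : ℝ, Λ (c₂ + y * I) * Complex.exp ((1 / 2 - (c₂ + y * I)) * (Real.log α + θ * I)) *
        ((c₂ + y * I) - 1 / 2) ^ n := by
  set F : ℂ → ℂ := fun s ↦ Λ s * Complex.exp ((1 / 2 - s) * (Real.log α + θ * I)) *
    (s - 1 / 2) ^ n with hF
  have hFd : Differentiable ℂ F := by
    simp only [hF]
    fun_prop
  obtain ⟨C, hC0, k, hCk⟩ := hΛ c₁ c₂
  set R : ℝ := max |c₁| |c₂| with hR
  set κ : ℝ := π / 2 - |θ| with hκ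
  have hκ0 : 0 < κ := by rw [hκ]; linarith
  set K : ℝ := C * (1 + R) ^ (k + n) * max (α ^ (1 / 2 - c₁)) (α ^ (1 / 2 - c₂)) with hK
  have hK0 : 0 ≤ K := by positivity
  -- the uniform bound on the closed strip
  have hbound : ∀ x : ℝ, c₁ ≤ x → x ≤ c₂ → ∀ y : ℝ,
      ‖F (x + y * I)‖ ≤ K * ((1 + |y|) ^ (k + n) * Real.exp (-(κ * |y|))) := by
    intro x hx1 hx2 y
    have hxR : |x| ≤ R := by
      rw [hR, abs_le]
      constructor
      · have := neg_abs_le c₁; have := le_max_left |c₁| |c₂|; linarith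
      · have := le_abs_self c₂; have := le_max_right |c₁| |c₂|; linarith
    simpa [hF, hK, hκ] using norm_integrand_le hCk hC0 hα θ n hx1 hx2 hxR y
  -- integrability on a line of the strip
  have hint : ∀ x : ℝ, c₁ ≤ x → x ≤ c₂ → Integrable fun y : ℝ ↦ F (x + y * I) := by
    intro x hx1 hx2
    have hcont : Continuous fun y : ℝ ↦ F (x + y * I) :=
      hFd.continuous.comp (by fun_prop)
    have hmaj : Integrable fun y : ℝ ↦ K * ((1 + |y|) ^ ((k + n : ℕ) : ℝ) * Real.exp (-(κ * |y|))) :=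
      (Literature.Analysis.SpecialFunctions.integrable_one_add_abs_rpow_mul_exp_neg hκ0
        (by positivity)).const_mul K
    refine hmaj.mono' hcont.aestronglyMeasurable (Eventually.of_forall fun y ↦ ?_)
    rw [Real.rpow_natCast]
    exact hbound x hx1 hx2 y
  -- decay on the horizontal segments
  have hdecay : ∀ ε : ℝ, 0 < ε → ∃ T₀ : ℝ, ∀ T : ℝ, T₀ ≤ |T| → ∀ x ∈ Icc c₁ c₂,
      ‖F (x + T * I)‖ ≤ ε := by
    intro ε hε
    obtain ⟨T₀, hT₀⟩ := Literature.Analysis.Complex.exists_rpow_mul_exp_neg_le (K := 1)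
      (p := ((k + n : ℕ) : ℝ)) zero_le_one (by positivity) hκ0 (ε := ε / (K + 1)) (by positivity)
    refine ⟨T₀, fun T hT x hx ↦ ?_⟩
    have h1 := hbound x hx.1 hx.2 T
    have h2 := hT₀ T hT
    rw [Real.rpow_natCast] at h2
    calc ‖F (x + T * I)‖ ≤ K * ((1 + |T|) ^ (k + n) * Real.exp (-(κ * |T|))) := h1
      _ ≤ K * (ε / (K + 1)) := mul_le_mul_of_nonneg_left h2 hK0
      _ ≤ ε := by
          rw [mul_div_assoc']
          rw [div_le_iff₀ (by positivity)]
          nlinarith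
  exact Literature.Analysis.Complex.integral_vertical_eq_of_differentiableOn hc
    (hFd.differentiableOn) (hint c₁ le_rfl hc) (hint c₂ hc le_rfl) hdecay


/-! ### Reflection `s ↦ 1 − s` and the functional equation -/

/-- Reflecting a vertical line integral: `∫ f(1 − ((1 − c) + iy)) dy = ∫ f(c + iy) dy`
(`1 − ((1−c) + iy) = c − iy` and `y ↦ −y`). [folklore] -/
theorem integral_vertical_reflect (f : ℂ → ℂ) (c : ℝ) :
    ∫ y : ℝ, f (1 - (((1 - c : ℝ) : ℂ) + y * I)) = ∫ y : ℝ, f (c + y * I) := by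
  have h := Measure.integral_comp_mul_left (fun y : ℝ ↦ f (c + y * I)) (-1 : ℝ)
  simp only [neg_mul, one_mul, inv_neg, inv_one, abs_neg, abs_one, one_smul] at h
  rw [← h]
  congr 1 with y
  congr 1
  push_cast
  ring

/-- **The functional equation reflected into the integrand.** If `Λ(s) = ε N^{1/2−s} Λ̃(1 − s)`
for all `s` (`N > 0`), then for `α > 0`, real `θ`, `n : ℕ` and every `w`,
`F(1 − w) = ε (−1)^n Λ̃(w) ((Nα)^{-1} e^{−iθ})^{1/2 − w} (w − 1/2)^n`, where
`F(s) = Λ(s) (αe^{iθ})^{1/2−s} (s − 1/2)^n` (Booker 2003, from (2) to (3): "using the functional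
equation (1) for `L(s, ρ)`, we arrive at (3)"). [cite: Booker2003, p. 1090, (1) and (3)] -/
theorem integrand_one_sub_eq {Λ Λd : ℂ → ℂ} {ε : ℂ} {N : ℝ} (hN : 0 < N)
    (hFE : ∀ s : ℂ, Λ s = ε * (N : ℂ) ^ (1 / 2 - s) * Λd (1 - s))
    {α : ℝ} (hα : 0 < α) (θ : ℝ) (n : ℕ) (w : ℂ) :
    Λ (1 - w) * Complex.exp ((1 / 2 - (1 - w)) * (Real.log α + θ * I)) * ((1 - w) - 1 / 2) ^ n =
      ε * (-1) ^ n * Λd w *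
        Complex.exp ((1 / 2 - w) * (Real.log (N * α)⁻¹ + (-θ) * I)) * (w - 1 / 2) ^ n := by
  have hNα : 0 < N * α := mul_pos hN hα
  rw [hFE (1 - w), sub_sub_cancel]
  -- `N^{1/2 - (1 - w)} = exp((w - 1/2) log N)`
  have hcpow : (N : ℂ) ^ (1 / 2 - (1 - w)) = Complex.exp ((w - 1 / 2) * Real.log N) := by
    rw [Complex.cpow_def_of_ne_zero (by exact_mod_cast hN.ne'), ← Complex.ofReal_log hN.le]
    congr 1; ring
  have hlog : (Real.log (N * α)⁻¹ : ℂ) = -(Real.log N + Real.log α) := by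
    rw [Real.log_inv, Real.log_mul hN.ne' hα.ne']; push_cast; ring
  have hpow : ((1 - w) - 1 / 2) ^ n = (-1) ^ n * (w - 1 / 2) ^ n := by
    rw [← mul_pow]; congr 1; ring
  rw [hcpow, hlog, hpow]
  -- combine the exponentials
  have hexp : Complex.exp ((w - 1 / 2) * Real.log N) *
      Complex.exp ((1 / 2 - (1 - w)) * (Real.log α + θ * I)) =
      Complex.exp ((1 / 2 - w) * (-(Real.log N + Real.log α) + (-θ) * I)) := by
    rw [← Complex.exp_add]; congr 1; ring
  calc ε * Complex.exp ((w - 1 / 2) * Real.log N) * Λd w *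
        Complex.exp ((1 / 2 - (1 - w)) * (Real.log α + θ * I)) * ((-1) ^ n * (w - 1 / 2) ^ n)
      = ε * (-1) ^ n * Λd w * (Complex.exp ((w - 1 / 2) * Real.log N) *
          Complex.exp ((1 / 2 - (1 - w)) * (Real.log α + θ * I))) * (w - 1 / 2) ^ n := by ring
    _ = _ := by rw [hexp]

/-! ### Booker's identity (3) in the entire case -/

/-- Integrability of the integrand on a vertical line under the strip decay of `Λ`. [folklore] -/
theorem integrable_integrand_vertical {Λ : ℂ → ℂ} (hΛd : Differentiable ℂ Λ)
    (hΛ : ∀ σ₁ σ₂ : ℝ, ∃ C : ℝ, 0 ≤ C ∧ ∃ k : ℕ, ∀ s : ℂ, σ₁ ≤ s.re → s.re ≤ σ₂ →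
      ‖Λ s‖ ≤ C * (1 + ‖s‖) ^ k * Real.exp (-(π * |s.im|) / 2))
    {α θ : ℝ} (hα : 0 < α) (hθ : |θ| < π / 2) (n : ℕ) (c : ℝ) :
    Integrable fun y : ℝ ↦ Λ (c + y * I) *
      Complex.exp ((1 / 2 - (c + y * I)) * (Real.log α + θ * I)) * ((c + y * I) - 1 / 2) ^ n := by
  obtain ⟨C, hC0, k, hCk⟩ := hΛ c c
  set κ : ℝ := π / 2 - |θ| with hκ
  have hκ0 : 0 < κ := by rw [hκ]; linarith
  set K : ℝ := C * (1 + |c|) ^ (k + n) * max (α ^ (1 / 2 - c)) (α ^ (1 / 2 - c)) with hK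
  have hcont : Continuous fun y : ℝ ↦ Λ (c + y * I) *
      Complex.exp ((1 / 2 - (c + y * I)) * (Real.log α + θ * I)) * ((c + y * I) - 1 / 2) ^ n := by
    have h1 : Continuous fun y : ℝ ↦ (c : ℂ) + y * I := by fun_prop
    exact ((hΛd.continuous.comp h1).mul (by fun_prop)).mul (by fun_prop)
  have hmaj : Integrable fun y : ℝ ↦ K * ((1 + |y|) ^ ((k + n : ℕ) : ℝ) * Real.exp (-(κ * |y|))) :=
    (Literature.Analysis.SpecialFunctions.integrable_one_add_abs_rpow_mul_exp_neg hκ0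
      (by positivity)).const_mul K
  refine hmaj.mono' hcont.aestronglyMeasurable (Eventually.of_forall fun y ↦ ?_)
  rw [Real.rpow_natCast]
  simpa [hK, hκ] using norm_integrand_le hCk hC0 hα θ n le_rfl le_rfl le_rfl y

/-- **Booker 2003, identity (3) in the entire case.** Let `Λ`, `Λ̃` be ENTIRE with
`Λ(s) = ε N^{1/2−s} Λ̃(1 − s)` (`N > 0`) — the completed functional equation (1),
`Λ = γ L`, `Λ̃ = γ L̄` — and let `Λ` satisfy `‖Λ(s)‖ ≤ C (1+‖s‖)^k e^{−π|Im s|/2}` in every vertical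
strip (polynomial growth of `L` times Stirling for `γ`). Then for `α > 0`, `|θ| < π/2` (Booker:
`θ = π/2 − δ`), `n : ℕ` (Booker: `m − a`) and every abscissa `c`,
`∫_{Re s = c} [Λ(s) (αe^{iθ})^{1/2−s} − ε(−1)^n Λ̃(s) ((Nα)^{-1}e^{−iθ})^{1/2−s}] (s − 1/2)^n ds = 0`
— i.e. the expression (3) of the (here empty) sum (2) over the poles of `L(s, ρ)` vanishes when
`L(s, ρ)` is entire: the first half is the line integral of `F` at `c`, the second is that of
`F(1 − ·)`, i.e. of `F` at `1 − c` reflected, and the two lines carry the same integral.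
[cite: Booker2003, p. 1090, (2)–(3)] -/
theorem integral_eq3_eq_zero {Λ Λd : ℂ → ℂ} (hΛd : Differentiable ℂ Λ)
    (hΛ : ∀ σ₁ σ₂ : ℝ, ∃ C : ℝ, 0 ≤ C ∧ ∃ k : ℕ, ∀ s : ℂ, σ₁ ≤ s.re → s.re ≤ σ₂ →
      ‖Λ s‖ ≤ C * (1 + ‖s‖) ^ k * Real.exp (-(π * |s.im|) / 2))
    {ε : ℂ} {N : ℝ} (hN : 0 < N) (hFE : ∀ s : ℂ, Λ s = ε * (N : ℂ) ^ (1 / 2 - s) * Λd (1 - s))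
    {α θ : ℝ} (hα : 0 < α) (hθ : |θ| < π / 2) (n : ℕ) (c : ℝ) :
    ∫ y : ℝ, (Λ (c + y * I) * Complex.exp ((1 / 2 - (c + y * I)) * (Real.log α + θ * I)) -
        ε * (-1) ^ n * Λd (c + y * I) *
          Complex.exp ((1 / 2 - (c + y * I)) * (Real.log (N * α)⁻¹ + (-θ) * I))) *
        ((c + y * I) - 1 / 2) ^ n = 0 := by
  set F : ℂ → ℂ := fun s ↦ Λ s * Complex.exp ((1 / 2 - s) * (Real.log α + θ * I)) *
    (s - 1 / 2) ^ n with hF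
  -- the two halves as line integrals of `F`
  have hG : ∀ w : ℂ, ε * (-1) ^ n * Λd w *
      Complex.exp ((1 / 2 - w) * (Real.log (N * α)⁻¹ + (-θ) * I)) * (w - 1 / 2) ^ n = F (1 - w) := by
    intro w; rw [hF]; exact (integrand_one_sub_eq hN hFE hα θ n w).symm
  have hint1 : Integrable fun y : ℝ ↦ F (c + y * I) := by
    simpa [hF] using integrable_integrand_vertical hΛd hΛ hα hθ n c
  have hint2 : Integrable fun y : ℝ ↦ F (1 - ((c : ℂ) + y * I)) := by
    have h := (integrable_integrand_vertical hΛd hΛ hα hθ n (1 - c)).comp_neg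
    refine h.congr (Eventually.of_forall fun y ↦ ?_)
    simp only [hF]
    have : ((1 - c : ℝ) : ℂ) + ((-y : ℝ) : ℂ) * I = 1 - ((c : ℂ) + y * I) := by push_cast; ring
    rw [this]
  -- `∫ F(c + iy) = ∫ F((1 - c) + iy) = ∫ F(1 - (c + iy))`
  have hshift : ∫ y : ℝ, F (c + y * I) = ∫ y : ℝ, F (((1 - c : ℝ) : ℂ) + y * I) := by
    rcases le_total c (1 - c) with h | h
    · exact integral_vertical_eq_of_decay hΛd hΛ hα hθ n h
    · exact (integral_vertical_eq_of_decay hΛd hΛ hα hθ n h).symm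
  have hrefl : ∫ y : ℝ, F (1 - ((c : ℂ) + y * I)) = ∫ y : ℝ, F (((1 - c : ℝ) : ℂ) + y * I) := by
    have h := integral_vertical_reflect F (1 - c)
    have e : ((1 - (1 - c) : ℝ) : ℂ) = (c : ℂ) := by push_cast; ring
    rw [e] at h
    exact h
  -- conclude
  have hsplit : ∀ y : ℝ, (Λ (c + y * I) * Complex.exp ((1 / 2 - (c + y * I)) * (Real.log α + θ * I)) -
        ε * (-1) ^ n * Λd (c + y * I) *
          Complex.exp ((1 / 2 - (c + y * I)) * (Real.log (N * α)⁻¹ + (-θ) * I))) *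
        ((c + y * I) - 1 / 2) ^ n = F (c + y * I) - F (1 - ((c : ℂ) + y * I)) := by
    intro y
    rw [← hG, hF]; ring
  simp_rw [hsplit]
  rw [integral_sub hint1 hint2, hshift, hrefl, sub_self]

end Booker2003

end Literature.NumberTheory.Automorphic

end
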